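import Literature.NumberTheory.IwasawaTheory.Fukuda1994Thm1RankPackage
import Literature.NumberTheory.IwasawaTheory.FukudaGroupLayers
import Literature.NumberTheory.IwasawaTheory.FukudaRankJumpAlgebra
import Literature.NumberTheory.IwasawaTheory.ClassicalLambdaLeStableRank
import Literature.NumberTheory.IwasawaTheory.NarrowFukudaRankMonotone
import Literature.NumberTheory.IwasawaTheory.CyclotomicTwoTotallyRamifiedOddIndex
import HarnessLib

/-!
# THE RANK-JUMP DOOR: `rank_p Cl(K_{n+k}) - rank_p Cl(K_{n+j}) < p^k - p^j` for ONE pair of layers `n + j ≤ n + k` (`n ≥` Fukuda's index)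
# freezes `rank_p Cl(K_m)` from `m = n + k` on — hence `μ = 0` and `λ ≤ rank_p Cl(K_{n+k})` (proved, finite level)

`Proofs`-style file (theorems only: no definition, no named fact, no `sorry`) in topic `NumberTheory/IwasawaTheory`
(namespace = path), written by the prover seat `bsd-line-att-p3` g40 (cell `bsd-f1-sign2`, WIDTH-5 attach on route `AlignedTransportAtTwo`;
`--supports` stmt-BirchSwinnertonDyer-22298, closes nothing; no class group is computed here).

THE THEOREM (`classGroupPRank_eq_of_add_pow_lt_add_pow`).  `K` a number field, `p` a prime, `κ` a `ℤ_p`-extension of `K` totally ramified at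
every ramified prime from layer `n₀` (`TotallyRamifiedFrom κ n₀`), `n ≥ n₀`, `j ≤ k`.  IF `r_{n+k} + p^j < r_{n+j} + p^k` — i.e. the `p`-rank
`r_m = rank_p Cl(K_m)` JUMPS BY LESS THAN `p^k - p^j` between the layers `n + j` and `n + k` — THEN `r_m = r_{n+k}` for EVERY `m ≥ n + k`.
Consequently (`classicalMuVanishes_and_classicalLambda_le_of_add_pow_lt_add_pow`, through the tree's `classicalLambda_le_of_forall_classGroupPRank_le`)
Iwasawa's `μ`-invariant of `κ` vanishes and `λ ≤ r_{n+k}`.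

SPECIAL FORMS (§3).  (j,k) = (0,1): `r_{n+1} ≤ r_n + (p - 2)` freezes the ranks from `n + 1` (`classGroupPRank_eq_of_succ_add_two_le`) — for `p = 2`
this is Fukuda's hypothesis `r_{n+1} = r_n` (Thm. 1 (2), tree `fukuda1994_thm1_classGroupPRank_const_of_succ_eq_holds`, which is thus the jump-`0`
case), for `p = 3` a jump of `1` is still conclusive; (j,k) = (0,k): `r_{n+k} + 1 < r_n + p^k` (`classGroupPRank_eq_of_add_one_lt_add_pow`) — the
tree's ONE-LAYER small-rank criterion `classGroupPRank_le_of_lt_pow_sub_one` (`r_{n+k} < p^k - 1`, cell `bsd-potss`) is the sub-case that forgets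
`r_n`; (j,k) = (1,2) at `p = 2`: **`rank₂ Cl(K_{n+2}) ≤ rank₂ Cl(K_{n+1}) + 1 ⟹` ranks frozen from `n + 2`, `μ₂ = 0`, `λ₂ ≤ rank₂ Cl(K_{n+2})`**
(`classGroupPRank_eq_of_le_succ_two`, `classicalMuVanishes_and_classicalLambda_le_of_le_succ_two`), and its W-free packaging for a field of odd
degree and odd discriminant with `κ` cyclotomic (Fukuda index `0`, tree `totallyRamifiedFrom_zero_of_not_dvd_discr`):
`classicalMuVanishes_two_of_classGroupPRank_two_le_of_not_dvd_discr` — e.g. a complex cubic field `F` with `2` split and `h(F)` odd, where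
`rank₂ Cl(F_1) ∈ {1, 2}` is known from genus theory and the door reads «`rank₂ Cl(F_2) ≤ rank₂ Cl(F_1) + 1`».

WHY (Washington §13.3 in one line: if `μ > 0` then `X/pX` has a free `𝔽_p⟦T⟧`-summand, which alone makes `rank_p A_{n+k} - rank_p A_{n+j} ≥ p^k - p^j`).
At finite level: the package `exists_layer_package` (`G = Gal(H_p(K_{n+t})/K_n)`, `A = Gal(H_p/K_{n+t})`, `φ` = conjugation by a totally ramified
inertia generator `g`, `Y₀ = N₀ ∩ A`, `φ`-STABLE by `FukudaGroup.conjEnd_mem_subOf_commutator_sup`) gives `p^{r_{n+i}} = [G_i : N_i P_i] = #(A/(ν_i Y₀ + pA))`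
for all `i ≤ t` (`FukudaGroup.relIndex_commutator_sup_layer_pow_mul_card`, Washington Lemma 13.18 mod `p`); the rank-jump lemma
(`FukudaRankJump.card_quotient_eq_of_card_quotient_mul_lt`: on `A/pA`, `ν_i = T^{p^i - 1}` with `T = φ - 1` nilpotent, `Ȳ₀` is `T`-stable, and the
chain `Ȳ₀ ⊇ TȲ₀ ⊇ ⋯` is strict while non-zero) turns `#(A/(ν_kY₀+pA)) · p^{p^j} < #(A/(ν_jY₀+pA)) · p^{p^k}` into `#(A/(ν_{k'}Y₀+pA)) = #(A/(ν_kY₀+pA))`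
for every `k ≤ k' ≤ t`; `t` is arbitrary.

COMPARISON.  Fukuda's Thm. 1 (2) needs two CONSECUTIVE layers with EQUAL ranks; the small-rank criterion needs ONE layer of rank `< p^k - 1`; this door
accepts ANY two layers whose ranks differ by less than `p^k - p^j` and implies rank constancy from the upper layer — both earlier doors are sub-cases
(jump `0`; lower layer forgotten).  Not found in print in this form; the ingredients are Washington's Lemma 13.18 / Prop. 13.22–13.23 and
Fukuda's finite-level method, cited at each use (D-0014: our proof of a statement assembled from cited ingredients).

References: [Washington1997] L. Washington, *Introduction to Cyclotomic Fields*, 2nd ed., §13.3 Lemmas 13.15, 13.18, Prop. 13.22, 13.23, Thm. 13.13;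
[Fukuda1994] T. Fukuda, *Remarks on ℤ_p-extensions of number fields*, Proc. Japan Acad. 70 A (1994), Thm. 1, p. 264.
-/

set_option autoImplicit false

noncomputable section

open scoped NumberField IsMulCommutative
open NumberField Field Finset

namespace Literature.NumberTheory.IwasawaTheory

open Literature.NumberTheory.EllipticCurves

variable {K : Type} [Field K] [NumberField K] {p : ℕ} [hp : Fact p.Prime]

/-! ## §1 Inside the package: `r_{n+k'} = r_{n+k}` for `k ≤ k' ≤ t` whenever `r_{n+k} + p^j < r_{n+j} + p^k` -/

/-- The finite-level step: in the package of `K_n ⊆ K_{n+t} ⊆ H_p(K_{n+t})` (`1 ≤ t`, `j ≤ k ≤ k' ≤ t`), `r_{n+k} + p^j < r_{n+j} + p^k` gives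
`r_{n+k'} = r_{n+k}` (`r_i = rank_p Cl(K_i)`). [cite: Washington1997, §13.3 Lemma 13.18 and Prop. 13.22] [cite: Fukuda1994, Thm. 1 (proof, p. 264)] -/
private theorem layer_rank_jump (κ : ZpExtension K p) {n₀ n : ℕ} (hκ : TotallyRamifiedFrom κ n₀) (hn : n₀ ≤ n) {j k k' t : ℕ}
    (ht : 1 ≤ t) (hjk : j ≤ k) (hkk' : k ≤ k') (hk't : k' ≤ t)
    (hjump : classGroupPRank κ (n + k) + p ^ j < classGroupPRank κ (n + j) + p ^ k) :
    classGroupPRank κ (n + k') = classGroupPRank κ (n + k) := by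
  classical
  have hp1 : 1 < p := hp.out.one_lt
  have hkt : k ≤ t := hkk'.trans hk't
  have hjt : j ≤ t := hjk.trans hkt
  obtain ⟨G, _instG, _instF, A', hA'n, _instC, g, 𝓘, hgA, hgen, hA'index, h𝓘, hg𝓘, -, hlayer⟩ :=
    exists_layer_package κ hκ hn t ht
  obtain ⟨Gj, hAGj, hGj, -, hrj⟩ := hlayer j hjt
  obtain ⟨Gk, hAGk, hGk, -, hrk⟩ := hlayer k hkt
  obtain ⟨Gk', hAGk', hGk', -, hrk'⟩ := hlayer k' hk't
  -- the data of the rank-jump lemma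
  set Y : Submodule ℤ (Additive A') := FukudaGroup.subOf A' (⁅(⊤ : Subgroup G), ⊤⁆ ⊔ ⨆ I ∈ 𝓘, I) with hY
  set φ : Module.End ℤ (Additive A') := FukudaGroup.conjEnd A' g with hφ
  set P : Submodule ℤ (Additive A') := (⊤ : Submodule ℤ (Additive A')).map ((p : ℤ) • (1 : Module.End ℤ (Additive A')))
    with hP
  have hφt : φ ^ p ^ t = 1 := FukudaGroup.conjEnd_pow_index_eq_one hgA hgen hA'index
  -- `Y₀` is `φ`-stable (Washington Lemma 13.15)
  have hYφ : Y.map φ ≤ Y := by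
    rintro _ ⟨y, hy, rfl⟩
    exact FukudaGroup.conjEnd_mem_subOf_commutator_sup hgA hgen hA'index h𝓘 hg𝓘 hy
  -- `#(A/(ν_i Y + pA)) = p^{r_{n+i}}` for `i = j, k, k'`
  have hquot : ∀ {i : ℕ} (hi : i ≤ t) {Gi : Subgroup G} (hAGi : A' ≤ Gi) (hGi : Gi.index = p ^ i),
      ((⁅Gi, Gi⁆ ⊔ ⨆ I ∈ 𝓘, I ⊓ Gi) ⊔ Subgroup.closure ((fun x : G => x ^ p) '' (Gi : Set G))).relIndex Gi =
        Nat.card (Additive A' ⧸ (Y.map (∑ l ∈ range (p ^ i), φ ^ l) ⊔ P)) := by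
    intro i hi Gi hAGi hGi
    have hmul := FukudaGroup.relIndex_commutator_sup_layer_pow_mul_card hgA hgen hA'index h𝓘 hg𝓘 hi hAGi hGi
    have hcard : Nat.card A' = Nat.card ↥(Y.map (∑ l ∈ range (p ^ i), φ ^ l) ⊔ P) *
        Nat.card (Additive A' ⧸ (Y.map (∑ l ∈ range (p ^ i), φ ^ l) ⊔ P)) :=
      Submodule.card_eq_card_quotient_mul_card (Y.map (∑ l ∈ range (p ^ i), φ ^ l) ⊔ P)
    rw [hcard, mul_comm (Nat.card ↥(Y.map _ ⊔ P))] at hmul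
    exact Nat.eq_of_mul_eq_mul_right Nat.card_pos hmul
  have hqj := hquot hjt hAGj hGj
  have hqk := hquot hkt hAGk hGk
  have hqk' := hquot hk't hAGk' hGk'
  rw [hrj] at hqj
  rw [hrk] at hqk
  rw [hrk'] at hqk'
  -- the rank-jump lemma
  have hlt : Nat.card (Additive A' ⧸ (Y.map (∑ l ∈ range (p ^ k), φ ^ l) ⊔ P)) * p ^ (p ^ j) <
      Nat.card (Additive A' ⧸ (Y.map (∑ l ∈ range (p ^ j), φ ^ l) ⊔ P)) * p ^ (p ^ k) := by
    rw [← hqj, ← hqk, ← pow_add, ← pow_add]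
    exact Nat.pow_lt_pow_right hp1 hjump
  have heq := FukudaRankJump.card_quotient_eq_of_card_quotient_mul_lt φ hφt Y hYφ hjk hlt hkk'
  rw [← hqk, ← hqk'] at heq
  exact Nat.pow_right_injective hp.out.two_le heq

/-! ## §2 The door along the tower -/

/-- ★★ **THE RANK-JUMP DOOR.**  `κ` a `ℤ_p`-extension of the number field `K`, totally ramified at the ramified primes from layer `n₀`
(`TotallyRamifiedFrom κ n₀`), `n₀ ≤ n`, `j ≤ k`: if `rank_p Cl(K_{n+k}) + p^j < rank_p Cl(K_{n+j}) + p^k` (the rank jumps by LESS than `p^k - p^j`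
between the layers `n + j` and `n + k`), then `rank_p Cl(K_m) = rank_p Cl(K_{n+k})` for every `m ≥ n + k`.
[cite: Washington1997, §13.3 Lemma 13.18 and Prop. 13.22–13.23] [cite: Fukuda1994, Thm. 1 (proof, p. 264)] -/
theorem classGroupPRank_eq_of_add_pow_lt_add_pow (κ : ZpExtension K p) {n₀ n : ℕ} (hκ : TotallyRamifiedFrom κ n₀) (hn : n₀ ≤ n)
    {j k : ℕ} (hjk : j ≤ k) (hjump : classGroupPRank κ (n + k) + p ^ j < classGroupPRank κ (n + j) + p ^ k)
    {m : ℕ} (hm : n + k ≤ m) : classGroupPRank κ m = classGroupPRank κ (n + k) := by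
  obtain ⟨d, rfl⟩ := Nat.exists_eq_add_of_le hm
  rw [add_assoc]
  exact layer_rank_jump κ hκ hn (t := k + d + 1) (by omega) hjk (Nat.le_add_right k d) (by omega) hjump

/-- ★★ **`μ = 0` and `λ ≤ rank_p Cl(K_{n+k})` from a small rank jump.**  Under `TotallyRamifiedFrom κ n₀`, `n₀ ≤ n`, `j ≤ k` and
`rank_p Cl(K_{n+k}) + p^j < rank_p Cl(K_{n+j}) + p^k`: the ranks are `≤ rank_p Cl(K_{n+k})` from layer `n + k` on, so (tree
`classicalLambda_le_of_forall_classGroupPRank_le`) `ClassicalMuVanishes κ` and `classicalLambda κ ≤ rank_p Cl(K_{n+k})`.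
[cite: Washington1997, §13.3 Prop. 13.23 and Thm. 13.13] [cite: Fukuda1994, Thm. 1 (2), p. 264] -/
theorem classicalMuVanishes_and_classicalLambda_le_of_add_pow_lt_add_pow (κ : ZpExtension K p) {n₀ n : ℕ} (hκ : TotallyRamifiedFrom κ n₀)
    (hn : n₀ ≤ n) {j k : ℕ} (hjk : j ≤ k) (hjump : classGroupPRank κ (n + k) + p ^ j < classGroupPRank κ (n + j) + p ^ k) :
    ClassicalMuVanishes κ ∧ classicalLambda κ ≤ classGroupPRank κ (n + k) :=
  classicalLambda_le_of_forall_classGroupPRank_le κ hκ (show n₀ ≤ n + k by omega)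
    fun _ hm => (classGroupPRank_eq_of_add_pow_lt_add_pow κ hκ hn hjk hjump hm).le

/-- `μ = 0` from a small rank jump (first half of the previous theorem). [cite: Washington1997, §13.3 Prop. 13.23] [cite: Fukuda1994, Thm. 1 (2), p. 264] -/
theorem classicalMuVanishes_of_add_pow_lt_add_pow (κ : ZpExtension K p) {n₀ n : ℕ} (hκ : TotallyRamifiedFrom κ n₀) (hn : n₀ ≤ n)
    {j k : ℕ} (hjk : j ≤ k) (hjump : classGroupPRank κ (n + k) + p ^ j < classGroupPRank κ (n + j) + p ^ k) :
    ClassicalMuVanishes κ :=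
  (classicalMuVanishes_and_classicalLambda_le_of_add_pow_lt_add_pow κ hκ hn hjk hjump).1

/-- `λ ≤ rank_p Cl(K_{n+k})` from a small rank jump (second half). [cite: Washington1997, §13.3 Prop. 13.23 and Thm. 13.13]
[cite: Fukuda1994, Thm. 1 (2), p. 264] -/
theorem classicalLambda_le_of_add_pow_lt_add_pow (κ : ZpExtension K p) {n₀ n : ℕ} (hκ : TotallyRamifiedFrom κ n₀) (hn : n₀ ≤ n)
    {j k : ℕ} (hjk : j ≤ k) (hjump : classGroupPRank κ (n + k) + p ^ j < classGroupPRank κ (n + j) + p ^ k) :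
    classicalLambda κ ≤ classGroupPRank κ (n + k) :=
  (classicalMuVanishes_and_classicalLambda_le_of_add_pow_lt_add_pow κ hκ hn hjk hjump).2

/-! ## §3 Special forms -/

/-- **First step: `rank_p Cl(K_{n+1}) ≤ rank_p Cl(K_n) + (p - 2)` (`n ≥ n₀`) freezes the ranks from layer `n + 1`** ((j,k) = (0,1): jump `< p - 1`).
For `p = 2` the hypothesis is Fukuda's `r_{n+1} = r_n` (the ranks never decrease above `n₀`); for `p = 3` a jump of `1` is allowed; Fukuda's Thm. 1 (2)
(tree `fukuda1994_thm1_classGroupPRank_const_of_succ_eq_holds`) is the jump-`0` sub-case for every `p`.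
[cite: Fukuda1994, Thm. 1 (2), p. 264] [cite: Washington1997, §13.3 Prop. 13.22–13.23] -/
theorem classGroupPRank_eq_of_succ_add_two_le (κ : ZpExtension K p) {n₀ n : ℕ} (hκ : TotallyRamifiedFrom κ n₀) (hn : n₀ ≤ n)
    (hjump : classGroupPRank κ (n + 1) + 2 ≤ classGroupPRank κ n + p) {m : ℕ} (hm : n + 1 ≤ m) :
    classGroupPRank κ m = classGroupPRank κ (n + 1) :=
  classGroupPRank_eq_of_add_pow_lt_add_pow κ hκ hn (j := 0) (k := 1) (Nat.zero_le 1)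
    (by rw [pow_zero, pow_one, add_zero]; omega) hm

/-- `μ = 0` and `λ ≤ rank_p Cl(K_{n+1})` from the first-step form `rank_p Cl(K_{n+1}) ≤ rank_p Cl(K_n) + (p - 2)`, `n ≥ n₀`.
[cite: Fukuda1994, Thm. 1 (2), p. 264] [cite: Washington1997, §13.3 Prop. 13.23 and Thm. 13.13] -/
theorem classicalMuVanishes_and_classicalLambda_le_of_succ_add_two_le (κ : ZpExtension K p) {n₀ n : ℕ} (hκ : TotallyRamifiedFrom κ n₀)
    (hn : n₀ ≤ n) (hjump : classGroupPRank κ (n + 1) + 2 ≤ classGroupPRank κ n + p) :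
    ClassicalMuVanishes κ ∧ classicalLambda κ ≤ classGroupPRank κ (n + 1) :=
  classicalMuVanishes_and_classicalLambda_le_of_add_pow_lt_add_pow κ hκ hn (j := 0) (k := 1) (Nat.zero_le 1)
    (by rw [pow_zero, pow_one, add_zero]; omega)

/-- **One upper layer against the base: `rank_p Cl(K_{n+k}) + 1 < rank_p Cl(K_n) + p^k` (`n ≥ n₀`) freezes the ranks from `n + k`** ((j,k) = (0,k)).
Forgetting `rank_p Cl(K_n) ≥ 0` gives the tree's one-layer small-rank criterion `rank_p Cl(K_{n+k}) < p^k - 1` (`classGroupPRank_le_of_lt_pow_sub_one`),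
here with the sharper conclusion of rank CONSTANCY from `n + k`. [cite: Washington1997, §13.3 Lemma 13.18 and Prop. 13.22–13.23] [cite: Fukuda1994, Thm. 1 (proof, p. 264)] -/
theorem classGroupPRank_eq_of_add_one_lt_add_pow (κ : ZpExtension K p) {n₀ n : ℕ} (hκ : TotallyRamifiedFrom κ n₀) (hn : n₀ ≤ n)
    {k : ℕ} (hjump : classGroupPRank κ (n + k) + 1 < classGroupPRank κ n + p ^ k) {m : ℕ} (hm : n + k ≤ m) :
    classGroupPRank κ m = classGroupPRank κ (n + k) :=
  classGroupPRank_eq_of_add_pow_lt_add_pow κ hκ hn (j := 0) (Nat.zero_le k) (by rwa [pow_zero, add_zero]) hm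

/-- `μ = 0` and `λ ≤ rank_p Cl(K_{n+k})` from `rank_p Cl(K_{n+k}) + 1 < rank_p Cl(K_n) + p^k`, `n ≥ n₀` — in particular from the one-layer
hypothesis `rank_p Cl(K_{n+k}) < p^k - 1`. [cite: Washington1997, §13.3 Prop. 13.23 and Thm. 13.13] [cite: Fukuda1994, Thm. 1 (2), p. 264] -/
theorem classicalMuVanishes_and_classicalLambda_le_of_add_one_lt_add_pow (κ : ZpExtension K p) {n₀ n : ℕ} (hκ : TotallyRamifiedFrom κ n₀)
    (hn : n₀ ≤ n) {k : ℕ} (hjump : classGroupPRank κ (n + k) + 1 < classGroupPRank κ n + p ^ k) :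
    ClassicalMuVanishes κ ∧ classicalLambda κ ≤ classGroupPRank κ (n + k) :=
  classicalMuVanishes_and_classicalLambda_le_of_add_pow_lt_add_pow κ hκ hn (j := 0) (Nat.zero_le k) (by rwa [pow_zero, add_zero])

/-- **Consecutive layers `n + i ⊂ n + i + 1` (`n ≥ n₀`): a jump `< p^i (p - 1)` freezes the ranks from `n + i + 1`** ((j,k) = (i, i+1)), with `μ = 0` and
`λ ≤ rank_p Cl(K_{n+i+1})`. [cite: Washington1997, §13.3 Prop. 13.22–13.23 and Thm. 13.13] [cite: Fukuda1994, Thm. 1 (2), p. 264] -/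
theorem classGroupPRank_eq_and_classicalMuVanishes_of_succ_add_pow_lt (κ : ZpExtension K p) {n₀ n : ℕ} (hκ : TotallyRamifiedFrom κ n₀)
    (hn : n₀ ≤ n) {i : ℕ} (hjump : classGroupPRank κ (n + i + 1) + p ^ i < classGroupPRank κ (n + i) + p ^ (i + 1)) :
    (∀ m, n + i + 1 ≤ m → classGroupPRank κ m = classGroupPRank κ (n + i + 1)) ∧
      ClassicalMuVanishes κ ∧ classicalLambda κ ≤ classGroupPRank κ (n + i + 1) :=
  ⟨fun _ hm => classGroupPRank_eq_of_add_pow_lt_add_pow κ hκ hn (j := i) (k := i + 1) (Nat.le_succ i) hjump hm,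
    classicalMuVanishes_and_classicalLambda_le_of_add_pow_lt_add_pow κ hκ hn (j := i) (k := i + 1) (Nat.le_succ i) hjump⟩

/-! ### `p = 2`: a jump of at most ONE between the layers `n + 1` and `n + 2` -/

/-- ★ **`p = 2`, second step: `rank₂ Cl(K_{n+2}) ≤ rank₂ Cl(K_{n+1}) + 1` (`n ≥ n₀`) freezes the `2`-ranks from layer `n + 2`** ((j,k) = (1,2):
jump `< 2² - 2 = 2`).  Fukuda's certificate would need `rank₂ Cl(K_{n+2}) = rank₂ Cl(K_{n+1})`; a jump of exactly one is conclusive too.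
[cite: Washington1997, §13.3 Lemma 13.18 and Prop. 13.22–13.23] [cite: Fukuda1994, Thm. 1 (proof, p. 264)] -/
theorem classGroupPRank_eq_of_le_succ_two (κ : ZpExtension K 2) {n₀ n : ℕ} (hκ : TotallyRamifiedFrom κ n₀) (hn : n₀ ≤ n)
    (hjump : classGroupPRank κ (n + 2) ≤ classGroupPRank κ (n + 1) + 1) {m : ℕ} (hm : n + 2 ≤ m) :
    classGroupPRank κ m = classGroupPRank κ (n + 2) :=
  classGroupPRank_eq_of_add_pow_lt_add_pow κ hκ hn (j := 1) (k := 2) one_le_two (by norm_num; omega) hm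

/-- ★ **`p = 2`: `rank₂ Cl(K_{n+2}) ≤ rank₂ Cl(K_{n+1}) + 1` (`n ≥ n₀`) ⟹ `μ₂ = 0` and `λ₂ ≤ rank₂ Cl(K_{n+2})`.**
[cite: Washington1997, §13.3 Prop. 13.23 and Thm. 13.13] [cite: Fukuda1994, Thm. 1 (2), p. 264] -/
theorem classicalMuVanishes_and_classicalLambda_le_of_le_succ_two (κ : ZpExtension K 2) {n₀ n : ℕ} (hκ : TotallyRamifiedFrom κ n₀)
    (hn : n₀ ≤ n) (hjump : classGroupPRank κ (n + 2) ≤ classGroupPRank κ (n + 1) + 1) :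
    ClassicalMuVanishes κ ∧ classicalLambda κ ≤ classGroupPRank κ (n + 2) :=
  classicalMuVanishes_and_classicalLambda_le_of_add_pow_lt_add_pow κ hκ hn (j := 1) (k := 2) one_le_two (by norm_num; omega)

/-- ★★ **W-free packaging at `p = 2`: odd degree, odd discriminant, cyclotomic tower.**  `K` a number field of odd degree with `2 ∤ d_K`
(so every cyclotomic `ℤ₂`-extension of `K` has Fukuda index `0`, tree `totallyRamifiedFrom_zero_of_not_dvd_discr`), `κ` a cyclotomic
`ℤ₂`-extension, `n` any layer: **`rank₂ Cl(K_{n+2}) ≤ rank₂ Cl(K_{n+1}) + 1 ⟹` the `2`-ranks are constant from `K_{n+2}`, `μ₂ = 0`, and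
`λ₂ ≤ rank₂ Cl(K_{n+2})`.**  For a complex cubic field with `2` split and odd class number (`n = 0`): `rank₂ Cl(K_1) = 2 - u₀ ∈ {1,2}` by genus
theory (`u₀ = [ε ∉ N K_1ˣ]`), and the door reads «`rank₂ Cl(K_2) ≤ 3 - u₀`» on the single layer `K_2 = K(ζ_16)^+K`.
[cite: Fukuda1994, Thm. 1 (2), p. 264] [cite: Washington1997, §13.1 Lemma 13.3 and §13.3 Prop. 13.22–13.23, Thm. 13.13] -/
theorem classicalMuVanishes_two_of_classGroupPRank_two_le_of_not_dvd_discr (hK : ¬ 2 ∣ Module.finrank ℚ K)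
    (hd : ¬ (2 : ℤ) ∣ NumberField.discr K) (κ : ZpExtension K 2) (hκ : κ.IsCyclotomic) {n : ℕ}
    (hjump : classGroupPRank κ (n + 2) ≤ classGroupPRank κ (n + 1) + 1) :
    (∀ m, n + 2 ≤ m → classGroupPRank κ m = classGroupPRank κ (n + 2)) ∧
      ClassicalMuVanishes κ ∧ classicalLambda κ ≤ classGroupPRank κ (n + 2) :=
  have h0 : TotallyRamifiedFrom κ 0 := totallyRamifiedFrom_zero_of_not_dvd_discr hK hd κ hκ
  ⟨fun _ hm => classGroupPRank_eq_of_le_succ_two κ h0 (Nat.zero_le n) hjump hm,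
    classicalMuVanishes_and_classicalLambda_le_of_le_succ_two κ h0 (Nat.zero_le n) hjump⟩

/-- The layers `1 ⊂ 2` of the previous theorem («`∀ κ` cyclotomic» consumer form): for `K` of odd degree with `2 ∤ d_K`,
**`rank₂ Cl(K_2) ≤ rank₂ Cl(K_1) + 1` along a cyclotomic `ℤ₂`-extension `κ` ⟹ `μ₂(κ) = 0 ∧ λ₂(κ) ≤ rank₂ Cl(K_2)`** — ONE inequality between the
`2`-ranks of `K(√2)` and `K(ζ_16)^+K`. [cite: Fukuda1994, Thm. 1 (2), p. 264] [cite: Washington1997, §13.3 Prop. 13.23 and Thm. 13.13] -/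
theorem classicalMuVanishes_two_of_classGroupPRank_layer_two_le_of_not_dvd_discr (hK : ¬ 2 ∣ Module.finrank ℚ K)
    (hd : ¬ (2 : ℤ) ∣ NumberField.discr K) (κ : ZpExtension K 2) (hκ : κ.IsCyclotomic)
    (hjump : classGroupPRank κ 2 ≤ classGroupPRank κ 1 + 1) :
    ClassicalMuVanishes κ ∧ classicalLambda κ ≤ classGroupPRank κ 2 :=
  (classicalMuVanishes_two_of_classGroupPRank_two_le_of_not_dvd_discr hK hd κ hκ (n := 0)
    (by simpa only [Nat.zero_add] using hjump)).2

/-! ## §4 The ORDER-jump form: a rank jump never exceeds the corresponding jump of `e = ord_p h`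

In the package, `p^{e_{n+i}} = [G_i : N_i] = #(A/ν_iY₀)` and `p^{r_{n+i}} = #(A/(ν_iY₀ + pA))` with `ν_kY₀ ⊆ ν_jY₀` for `j ≤ k`
(`FukudaGroup.map_geom_sum_le_of_dvd`); the index of `ν_kY₀ + pA` in `ν_jY₀ + pA` is at most that of `ν_kY₀` in `ν_jY₀`, so
`r_{n+k} - r_{n+j} ≤ e_{n+k} - e_{n+j}` — and the rank-jump door fires from a small jump of `p`-CLASS NUMBERS. -/

/-- For submodules `S ≤ R` and `P` of a finite `ℤ`-module: `#(M/(S ⊔ P)) · #(M/R) ≤ #(M/(R ⊔ P)) · #(M/S)` — the image of `R` in `M/S` maps onto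
the image of `R ⊔ P` in `M/(S ⊔ P)`, so `[R ⊔ P : S ⊔ P] ≤ [R : S]`. [folklore] -/
private theorem card_quotient_sup_mul_le {M : Type*} [AddCommGroup M] [Finite M] {S R : Submodule ℤ M} (hSR : S ≤ R)
    (P : Submodule ℤ M) :
    Nat.card (M ⧸ (S ⊔ P)) * Nat.card (M ⧸ R) ≤ Nat.card (M ⧸ (R ⊔ P)) * Nat.card (M ⧸ S) := by
  have hSP : S ⊔ P ≤ R ⊔ P := sup_le_sup_right hSR P
  haveI : Finite (M ⧸ S) := Finite.of_surjective _ (Submodule.Quotient.mk_surjective S)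
  haveI : Finite (M ⧸ (S ⊔ P)) := Finite.of_surjective _ (Submodule.Quotient.mk_surjective (S ⊔ P))
  have h1 : Nat.card (M ⧸ (S ⊔ P)) = Nat.card ↥((R ⊔ P).map (S ⊔ P).mkQ) * Nat.card (M ⧸ (R ⊔ P)) := by
    rw [Submodule.card_eq_card_quotient_mul_card ((R ⊔ P).map (S ⊔ P).mkQ),
      Nat.card_congr (Submodule.quotientQuotientEquivQuotient (S ⊔ P) (R ⊔ P) hSP).toEquiv]
  have h2 : Nat.card (M ⧸ S) = Nat.card ↥(R.map S.mkQ) * Nat.card (M ⧸ R) := by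
    rw [Submodule.card_eq_card_quotient_mul_card (R.map S.mkQ),
      Nat.card_congr (Submodule.quotientQuotientEquivQuotient S R hSR).toEquiv]
  -- the image of `R` in `M/S` maps ONTO the image of `R ⊔ P` in `M/(S ⊔ P)`
  have hle : S ≤ (S ⊔ P).comap (LinearMap.id : M →ₗ[ℤ] M) := fun x hx => Submodule.mem_sup_left hx
  set π : (M ⧸ S) →ₗ[ℤ] (M ⧸ (S ⊔ P)) := S.mapQ (S ⊔ P) LinearMap.id hle with hπ
  have hπ_mk : ∀ m : M, π (Submodule.Quotient.mk m) = Submodule.Quotient.mk m := fun m => Submodule.mapQ_apply S (S ⊔ P) _ m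
  let f : ↥(R.map S.mkQ) → ↥((R ⊔ P).map (S ⊔ P).mkQ) := fun x => ⟨π x.1, by
    obtain ⟨r, hr, hx⟩ := Submodule.mem_map.mp x.2
    refine ⟨r, Submodule.mem_sup_left hr, ?_⟩
    rw [← hx, Submodule.mkQ_apply, Submodule.mkQ_apply, hπ_mk]⟩
  have hf : Function.Surjective f := by
    rintro ⟨y, hy⟩
    obtain ⟨m, hm, rfl⟩ := Submodule.mem_map.mp hy
    obtain ⟨r, hr, q, hq, rfl⟩ := Submodule.mem_sup.mp hm
    refine ⟨⟨S.mkQ r, Submodule.mem_map_of_mem hr⟩, Subtype.ext ?_⟩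
    show π (Submodule.Quotient.mk r) = Submodule.Quotient.mk (r + q)
    rw [hπ_mk, Submodule.Quotient.eq, sub_add_cancel_left]
    exact (S ⊔ P).neg_mem (Submodule.mem_sup_right hq)
  have h3 : Nat.card ↥((R ⊔ P).map (S ⊔ P).mkQ) ≤ Nat.card ↥(R.map S.mkQ) := Nat.card_le_card_of_surjective f hf
  have h4 := Nat.mul_le_mul_left (Nat.card (M ⧸ (R ⊔ P)) * Nat.card (M ⧸ R)) h3
  rw [h1, h2]
  calc Nat.card ↥((R ⊔ P).map (S ⊔ P).mkQ) * Nat.card (M ⧸ (R ⊔ P)) * Nat.card (M ⧸ R)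
      = Nat.card (M ⧸ (R ⊔ P)) * Nat.card (M ⧸ R) * Nat.card ↥((R ⊔ P).map (S ⊔ P).mkQ) := by ring
    _ ≤ Nat.card (M ⧸ (R ⊔ P)) * Nat.card (M ⧸ R) * Nat.card ↥(R.map S.mkQ) := h4
    _ = Nat.card (M ⧸ (R ⊔ P)) * (Nat.card ↥(R.map S.mkQ) * Nat.card (M ⧸ R)) := by ring

/-- ★ **A rank jump is at most the order jump: `rank_p Cl(K_{n+k}) + e_{n+j} ≤ rank_p Cl(K_{n+j}) + e_{n+k}`** for `n₀ ≤ n`, `j ≤ k`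
(`e_m = ord_p h(K_m)`).  Finite shadow of «`A_{n+k} ↠ A_{n+j}` and `rank B - rank C ≤ log_p #B - log_p #C` for a quotient `C` of `B`»: in the
package `p^{e_{n+i}} = #(A/ν_iY₀)`, `p^{r_{n+i}} = #(A/(ν_iY₀ + pA))`, `ν_kY₀ ⊆ ν_jY₀`. [cite: Washington1997, §13.3 Lemmas 13.15 and 13.18]
[cite: Fukuda1994, Thm. 1 (proof, p. 264)] -/
theorem classGroupPRank_add_classNumberPExp_le (κ : ZpExtension K p) {n₀ n : ℕ} (hκ : TotallyRamifiedFrom κ n₀) (hn : n₀ ≤ n)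
    {j k : ℕ} (hjk : j ≤ k) :
    classGroupPRank κ (n + k) + classNumberPExp κ (n + j) ≤ classGroupPRank κ (n + j) + classNumberPExp κ (n + k) := by
  classical
  have hp1 : 1 < p := hp.out.one_lt
  obtain ⟨G, _instG, _instF, A', hA'n, _instC, g, 𝓘, hgA, hgen, hA'index, h𝓘, hg𝓘, -, hlayer⟩ :=
    exists_layer_package κ hκ hn (k + 1) (Nat.succ_pos k)
  obtain ⟨Gj, hAGj, hGj, hej, hrj⟩ := hlayer j (hjk.trans (Nat.le_succ k))
  obtain ⟨Gk, hAGk, hGk, hek, hrk⟩ := hlayer k (Nat.le_succ k)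
  set Y : Submodule ℤ (Additive A') := FukudaGroup.subOf A' (⁅(⊤ : Subgroup G), ⊤⁆ ⊔ ⨆ I ∈ 𝓘, I) with hY
  set φ : Module.End ℤ (Additive A') := FukudaGroup.conjEnd A' g with hφ
  set P : Submodule ℤ (Additive A') := (⊤ : Submodule ℤ (Additive A')).map ((p : ℤ) • (1 : Module.End ℤ (Additive A')))
    with hP
  have hstab : ∀ y ∈ Y, φ y ∈ Y := fun y hy => FukudaGroup.conjEnd_mem_subOf_commutator_sup hgA hgen hA'index h𝓘 hg𝓘 hy
  -- `ν_k Y ⊆ ν_j Y`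
  have hSR : Y.map (∑ l ∈ range (p ^ k), φ ^ l) ≤ Y.map (∑ l ∈ range (p ^ j), φ ^ l) :=
    FukudaGroup.map_geom_sum_le_of_dvd φ Y hstab (pow_dvd_pow p hjk)
  -- `#(A/ν_iY) = p^{e_{n+i}}` and `#(A/(ν_iY + pA)) = p^{r_{n+i}}`
  have hquot_e : ∀ {i : ℕ} (hi : i ≤ k + 1) {Gi : Subgroup G} (hAGi : A' ≤ Gi) (hGi : Gi.index = p ^ i),
      (⁅Gi, Gi⁆ ⊔ ⨆ I ∈ 𝓘, I ⊓ Gi).relIndex Gi = Nat.card (Additive A' ⧸ Y.map (∑ l ∈ range (p ^ i), φ ^ l)) := by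
    intro i hi Gi hAGi hGi
    have hmul := FukudaGroup.relIndex_commutator_sup_layer_mul_card hgA hgen hA'index h𝓘 hg𝓘 hi hAGi hGi
    have hcard : Nat.card A' = Nat.card ↥(Y.map (∑ l ∈ range (p ^ i), φ ^ l)) *
        Nat.card (Additive A' ⧸ Y.map (∑ l ∈ range (p ^ i), φ ^ l)) :=
      Submodule.card_eq_card_quotient_mul_card (Y.map (∑ l ∈ range (p ^ i), φ ^ l))
    rw [hcard, mul_comm (Nat.card ↥(Y.map _))] at hmul
    exact Nat.eq_of_mul_eq_mul_right Nat.card_pos hmul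
  have hquot_r : ∀ {i : ℕ} (hi : i ≤ k + 1) {Gi : Subgroup G} (hAGi : A' ≤ Gi) (hGi : Gi.index = p ^ i),
      ((⁅Gi, Gi⁆ ⊔ ⨆ I ∈ 𝓘, I ⊓ Gi) ⊔ Subgroup.closure ((fun x : G => x ^ p) '' (Gi : Set G))).relIndex Gi =
        Nat.card (Additive A' ⧸ (Y.map (∑ l ∈ range (p ^ i), φ ^ l) ⊔ P)) := by
    intro i hi Gi hAGi hGi
    have hmul := FukudaGroup.relIndex_commutator_sup_layer_pow_mul_card hgA hgen hA'index h𝓘 hg𝓘 hi hAGi hGi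
    have hcard : Nat.card A' = Nat.card ↥(Y.map (∑ l ∈ range (p ^ i), φ ^ l) ⊔ P) *
        Nat.card (Additive A' ⧸ (Y.map (∑ l ∈ range (p ^ i), φ ^ l) ⊔ P)) :=
      Submodule.card_eq_card_quotient_mul_card (Y.map (∑ l ∈ range (p ^ i), φ ^ l) ⊔ P)
    rw [hcard, mul_comm (Nat.card ↥(Y.map _ ⊔ P))] at hmul
    exact Nat.eq_of_mul_eq_mul_right Nat.card_pos hmul
  have hqej := hquot_e (hjk.trans (Nat.le_succ k)) hAGj hGj
  have hqek := hquot_e (Nat.le_succ k) hAGk hGk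
  have hqrj := hquot_r (hjk.trans (Nat.le_succ k)) hAGj hGj
  have hqrk := hquot_r (Nat.le_succ k) hAGk hGk
  rw [hej] at hqej
  rw [hek] at hqek
  rw [hrj] at hqrj
  rw [hrk] at hqrk
  have h := card_quotient_sup_mul_le hSR P
  rw [← hqrk, ← hqej, ← hqrj, ← hqek, ← pow_add, ← pow_add] at h
  exact (Nat.pow_le_pow_iff_right hp1).mp h

/-- ★★ **THE ORDER-JUMP DOOR.**  `TotallyRamifiedFrom κ n₀`, `n₀ ≤ n`, `j ≤ k`, and `e_{n+k} + p^j < e_{n+j} + p^k` — the `p`-part of the CLASS NUMBER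
jumps by less than `p^k - p^j` between the layers `n + j` and `n + k` (`e_m = ord_p h(K_m)`): then `rank_p Cl(K_m) = rank_p Cl(K_{n+k})` for all
`m ≥ n + k`, `μ = 0`, and `λ ≤ rank_p Cl(K_{n+k})` (the rank jump is at most the order jump, `classGroupPRank_add_classNumberPExp_le`).
[cite: Washington1997, §13.3 Prop. 13.22–13.23 and Thm. 13.13] [cite: Fukuda1994, Thm. 1, p. 264] -/
theorem classGroupPRank_eq_and_classicalMuVanishes_of_classNumberPExp_add_pow_lt (κ : ZpExtension K p) {n₀ n : ℕ}
    (hκ : TotallyRamifiedFrom κ n₀) (hn : n₀ ≤ n) {j k : ℕ} (hjk : j ≤ k)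
    (hjump : classNumberPExp κ (n + k) + p ^ j < classNumberPExp κ (n + j) + p ^ k) :
    (∀ m, n + k ≤ m → classGroupPRank κ m = classGroupPRank κ (n + k)) ∧
      ClassicalMuVanishes κ ∧ classicalLambda κ ≤ classGroupPRank κ (n + k) := by
  have hr : classGroupPRank κ (n + k) + p ^ j < classGroupPRank κ (n + j) + p ^ k := by
    have h := classGroupPRank_add_classNumberPExp_le κ hκ hn hjk
    omega
  exact ⟨fun _ hm => classGroupPRank_eq_of_add_pow_lt_add_pow κ hκ hn hjk hr hm,
    classicalMuVanishes_and_classicalLambda_le_of_add_pow_lt_add_pow κ hκ hn hjk hr⟩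

/-- **`p = 2`, orders: `e_{n+2} ≤ e_{n+1} + 1` (`n ≥ n₀`) — the `2`-class number AT MOST DOUBLES from `K_{n+1}` to `K_{n+2}` — ⟹ `2`-ranks frozen from
`n + 2`, `μ₂ = 0`, `λ₂ ≤ rank₂ Cl(K_{n+2})`.**  (Where Fukuda's Thm. 1 (1) needs `e_{n+2} = e_{n+1}` and concludes `λ = 0` too, a doubling is still
conclusive for `μ`.) [cite: Fukuda1994, Thm. 1, p. 264] [cite: Washington1997, §13.3 Prop. 13.22–13.23 and Thm. 13.13] -/
theorem classGroupPRank_eq_and_classicalMuVanishes_two_of_classNumberPExp_le_succ (κ : ZpExtension K 2) {n₀ n : ℕ}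
    (hκ : TotallyRamifiedFrom κ n₀) (hn : n₀ ≤ n) (hjump : classNumberPExp κ (n + 2) ≤ classNumberPExp κ (n + 1) + 1) :
    (∀ m, n + 2 ≤ m → classGroupPRank κ m = classGroupPRank κ (n + 2)) ∧
      ClassicalMuVanishes κ ∧ classicalLambda κ ≤ classGroupPRank κ (n + 2) :=
  classGroupPRank_eq_and_classicalMuVanishes_of_classNumberPExp_add_pow_lt κ hκ hn (j := 1) (k := 2) one_le_two
    (by norm_num; omega)

/-- ★★ **W-free packaging of the order form at `p = 2`**: `K` of odd degree with `2 ∤ d_K`, `κ` a cyclotomic `ℤ₂`-extension, `n` any layer: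
**`ord₂ h(K_{n+2}) ≤ ord₂ h(K_{n+1}) + 1 ⟹` `2`-ranks frozen from `K_{n+2}`, `μ₂ = 0`, `λ₂ ≤ rank₂ Cl(K_{n+2})`.**  On a complex cubic field with `2`
split and odd class number the `2`-class number grows at EVERY layer (genus theory), so there the door reads «`h₂(K_2) = 2·h₂(K_1)` exactly».
[cite: Fukuda1994, Thm. 1, p. 264] [cite: Washington1997, §13.1 Lemma 13.3 and §13.3 Prop. 13.22–13.23, Thm. 13.13] -/
theorem classicalMuVanishes_two_of_classNumberPExp_two_le_of_not_dvd_discr (hK : ¬ 2 ∣ Module.finrank ℚ K)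
    (hd : ¬ (2 : ℤ) ∣ NumberField.discr K) (κ : ZpExtension K 2) (hκ : κ.IsCyclotomic) {n : ℕ}
    (hjump : classNumberPExp κ (n + 2) ≤ classNumberPExp κ (n + 1) + 1) :
    (∀ m, n + 2 ≤ m → classGroupPRank κ m = classGroupPRank κ (n + 2)) ∧
      ClassicalMuVanishes κ ∧ classicalLambda κ ≤ classGroupPRank κ (n + 2) :=
  classGroupPRank_eq_and_classicalMuVanishes_two_of_classNumberPExp_le_succ κ
    (totallyRamifiedFrom_zero_of_not_dvd_discr hK hd κ hκ) (Nat.zero_le n) hjump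

/-- The layers `1 ⊂ 2` of the previous theorem: for `K` of odd degree with `2 ∤ d_K` and a cyclotomic `ℤ₂`-extension `κ`,
**`ord₂ h(K_2) ≤ ord₂ h(K_1) + 1 ⟹ μ₂(κ) = 0 ∧ λ₂(κ) ≤ rank₂ Cl(K_2)`** — ONE inequality between the `2`-parts of the class numbers of `K(√2)` and
`K(ζ_16)^+K`. [cite: Fukuda1994, Thm. 1, p. 264] [cite: Washington1997, §13.3 Prop. 13.23 and Thm. 13.13] -/
theorem classicalMuVanishes_two_of_classNumberPExp_layer_two_le_of_not_dvd_discr (hK : ¬ 2 ∣ Module.finrank ℚ K)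
    (hd : ¬ (2 : ℤ) ∣ NumberField.discr K) (κ : ZpExtension K 2) (hκ : κ.IsCyclotomic)
    (hjump : classNumberPExp κ 2 ≤ classNumberPExp κ 1 + 1) :
    ClassicalMuVanishes κ ∧ classicalLambda κ ≤ classGroupPRank κ 2 :=
  (classicalMuVanishes_two_of_classNumberPExp_two_le_of_not_dvd_discr hK hd κ hκ (n := 0)
    (by simpa only [Nat.zero_add] using hjump)).2

end Literature.NumberTheory.IwasawaTheory

end
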